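import Summits.NavierStokesRegularity.FluidComputer.PalasekTowerRegisterGlobalFloorsAt
import Summits.NavierStokesRegularity.FluidComputer.PalasekTowerHeredityWitnessWindow

/-!
# REGISTER v2.3′: the lower stub is a property of the SLICE — `ReadoutAt k P` (`k ≥ 1`) ⇔ «every free
# Navier–Stokes run over the window from a registered level-`k` slice, inside the next ceiling, ends with `P`»

Cell `ns-blowup`, seat `ns-palasek-19249-p2` (prover; D-0081 §C stub-worker on item
stmt-NavierStokesRegularity-19249 `HeredityAtOne`; registered line birth v3: stubs `AprioriCeilingAt 1`,
`SpeedFloorAt 1`, `StrainFloorAt 1`, `CoreFloorAt 1`). Companion of `PalasekTowerRegisterGlobalFloorsAt.lean`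
(this seat, p452333: the schema `ReadoutAt k P`, the three floors, the transfer `ReadoutAt.of_exists`), of
`PalasekTowerRegisterGlobalEnvelopeAt.lean` (ecbridge-7: `Stage.exists_glue_translated`) and
`PalasekTowerRegisterGlobalEnvelopeAtHolds.lean` (ecbridge-7 g3 / ecbridge-1 g6: `LocalContinuationAt k` is a
THEOREM — every registered stage crosses `τ k` classically, F2 = Tao 2013 Thm 5.4 with force), of
`PalasekTowerHeredityWitnessWindow.lean` (ecbridge-6 g3: the ε-OVERLAP window form of heredity, written when the
closed junction at `τ k` could not yet be crossed) and of the Literature lemma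
`IsClassicalNSSolutionOn.exists_pressure_eq_on_Icc` (ecbridge-8: pressure gauges can be matched on an initial
segment). LABEL: E–C typing (KERNEL: one predicate schema + PROVED equivalences; no named fact, nothing
asserted). WHAT THIS IS NOT: not Navier–Stokes evidence — no stage, flow or tower is constructed; the stubs stay
OPEN and appear only inside equivalences.

## What is typed and proved

* §1 `SliceRun S k P v` — the FREE-RUN schema: every classical solution `(w, r)` of the UNFORCED system on the
  window slab `[0, τ (k+1) − τ k]` with `w 0 = v`, of finite energy, inside the next ceiling `c₂ Y_{k+1}`, ends
  with `P S (w (τ (k+1) − τ k))`. Under rigidity the horizon is the registered number `c₅ log N_{k+1} / A_k`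
  (tree `Schedule.Rigid.window_length`, ecbridge-6).
* §2 the two conversions at a level `k ≥ 1` of a QUIET schedule (force silent from `τ 1 ≤ τ k` on), any rates,
  any viscosity `ν > 0`, any margin: `Stage.freeRun_of_continuation` (a continuation of a stage, translated to the
  origin `τ k`, is an unforced classical solution on the window slab) and **`Stage.exists_continuation_of_freeRun`**
  (an unforced, BOUNDED, finite-energy classical run `w` from the slice `s.u (τ k)` IS the translate of a classical
  finite-energy continuation `(u, p)` of the stage — agreeing with it in velocity AND pressure on `[0, τ k]` — given
  a local continuation of the stage across `τ k`: uniqueness on the overlap (`velocity_eq_of_bounded_classical_Icc`,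
  `w` is the bounded competitor), pressure gauge matched on the overlap (`exists_pressure_eq_on_Icc`), glue
  (`Stage.exists_glue_translated`)). This is the EXACT-SLICE form of ecbridge-6 g3's window restart: no `ε`, the
  run starts AT `τ k` from the stage's own slice.
* §3 **`readoutAt_iff_sliceRun (1 ≤ k)`**: on the wide rates at unit viscosity with the route margin,
  `ReadoutAt k P ↔ ∀ S pinned rigid quiet, ∀ s : Stage … k, SliceRun S k P (s.u (τ k))` — the local continuation
  is supplied by the tree (`localContinuationAt_of_forced_local_existence tao2011_smooth_local_existence_forced_holds`).
  Hence `speedFloorAt_iff_sliceRun`, `strainFloorAt_iff_sliceRun`, `coreFloorAt_iff_sliceRun`,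
  `readoutFloorsAt_iff_sliceRun`, and at the first rung `speedFloorAt_one_iff_sliceRun` etc.
* §4 the slice-form refutation template `not_readoutAt_of_lazy_slice`: ONE registered level-`k` stage and ONE
  tame free run from its slice on which `P` fails refute `ReadoutAt k P`.

READING (item 19249, `k = 1`): the three floor stubs depend on a registered level-1 stage ONLY THROUGH ITS SLICE
`u(τ₁)` (and the ball radius): they are statements about the free Navier–Stokes flow map over the fixed horizon
`W₁ = (253/25)·log N₂ / A₁ ≈ 5.5·10⁻⁵` on the set of registered level-1 slices — the forced history `[0, τ₁]`
enters only by deciding WHICH slices are registered (item 19179's question). A numerically found or designed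
level-1 profile is to be certified against `SliceRun`, not against the stage.

References: S. Palasek, arXiv:2605.13827 §4 [cite: Palasek2026ElementaryModel, §4]; H. Sohr, *The Navier–Stokes
Equations*, Birkhäuser 2001, Ch. V Thm. 1.5.1 [cite: Sohr2001, Ch. V Thm. 1.5.1]; J. T. Beale, T. Kato, A. Majda,
Comm. Math. Phys. 94 (1984) §1 [cite: BealeKatoMajda1984, §1]; C. R. Doering, J. D. Gibbon, *Applied Analysis of
the Navier–Stokes Equations*, CUP 1995, §1.2 [cite: DoeringGibbon1995, §1.2 eqs (1.2.17)–(1.2.21) (pp. 10–11)].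
-/

noncomputable section

namespace Summit.NavierStokesRegularity.FluidComputer.PalasekTowerClayBridge

open Set MeasureTheory Filter Topology Function Real
open scoped ENNReal ContDiff NNReal
open Literature.Analysis.FluidPDE
open Summit.NavierStokesRegularity.NavierStokesRegularity

/-! ## §1 The free-run schema -/

/-- **FREE-RUN SCHEMA of a slice.** For a wide schedule `S`, a level `k`, a readout predicate `P` and a
velocity slice `v`: every classical solution `(w, r)` of the UNFORCED Navier–Stokes system (unit viscosity) on
the window slab `[0, τ (k+1) − τ k]` with `w 0 = v`, of finite energy there and inside the next ceiling
`c₂ Y_{k+1}` on the slab, satisfies `P S (w (τ (k+1) − τ k))`. [cite: Palasek2026ElementaryModel, §4] -/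
def SliceRun (S : Schedule TowerRates.wide) (k : ℕ)
    (P : Schedule TowerRates.wide → (EuclideanSpace ℝ (Fin 3) → EuclideanSpace ℝ (Fin 3)) → Prop)
    (v : EuclideanSpace ℝ (Fin 3) → EuclideanSpace ℝ (Fin 3)) : Prop :=
  ∀ (w : ℝ → EuclideanSpace ℝ (Fin 3) → EuclideanSpace ℝ (Fin 3))
    (r : ℝ → EuclideanSpace ℝ (Fin 3) → ℝ),
    IsClassicalNSSolutionOn (Icc 0 (S.τ (k + 1) - S.τ k)) 1 0 w r →
    w 0 = v →
    (∃ C : ℝ≥0∞, C < ⊤ ∧ ∀ σ ∈ Icc 0 (S.τ (k + 1) - S.τ k), ∫⁻ x, ‖w σ x‖ₑ ^ 2 ≤ C) →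
    (∀ σ ∈ Icc 0 (S.τ (k + 1) - S.τ k), ∀ x, ‖w σ x‖ ≤ S.c₂ * TowerRates.wide.Y (k + 1)) →
    P S (w (S.τ (k + 1) - S.τ k))

/-- The schema is monotone in the predicate. [folklore] -/
theorem SliceRun.mono {S : Schedule TowerRates.wide} {k : ℕ}
    {P Q : Schedule TowerRates.wide → (EuclideanSpace ℝ (Fin 3) → EuclideanSpace ℝ (Fin 3)) → Prop}
    {v : EuclideanSpace ℝ (Fin 3) → EuclideanSpace ℝ (Fin 3)} (hPQ : ∀ w, P S w → Q S w)
    (h : SliceRun S k P v) : SliceRun S k Q v :=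
  fun w r hw hw0 hE hB => hPQ _ (h w r hw hw0 hE hB)

/-! ## §2 Continuations of a stage ↔ free runs from its slice (quiet schedule, level `k ≥ 1`) -/

namespace Stage

variable {ν : ℝ} {R : TowerRates} {S : Schedule R} {m : Margins R} {k : ℕ}

/-- **A continuation, translated to the origin `τ k`, is a free run.** On a quiet schedule (force silent from
`τ 1 ≤ τ k` on), a classical solution `(u, p)` of the design's system on `[0, τ (k+1)]` yields the UNFORCED
classical solution `σ ↦ (u, p)(σ + τ k)` on the window slab `[0, τ (k+1) − τ k]`. [cite: BealeKatoMajda1984, §1] -/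
theorem freeRun_of_continuation (hQ : S.Quiet) (hk : 1 ≤ k) (s : Stage ν R S m k)
    {u : ℝ → EuclideanSpace ℝ (Fin 3) → EuclideanSpace ℝ (Fin 3)} {p : ℝ → EuclideanSpace ℝ (Fin 3) → ℝ}
    (hcl : IsClassicalNSSolutionOn (Icc 0 (S.τ (k + 1))) ν S.f u p) :
    IsClassicalNSSolutionOn (Icc 0 (S.τ (k + 1) - S.τ k)) ν 0 (fun σ => u (σ + S.τ k))
      (fun σ => p (σ + S.τ k)) := by
  have _ := s
  have hW : 0 < S.τ (k + 1) - S.τ k := by linarith [S.τ_lt_succ k]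
  have hτk0 : 0 ≤ S.τ k := (S.τ_pos k).le
  have h1k : S.τ 1 ≤ S.τ k := S.τ_mono hk
  have hpre : Icc 0 (S.τ (k + 1) - S.τ k) ⊆ (fun σ => σ + S.τ k) ⁻¹' Icc 0 (S.τ (k + 1)) := by
    intro σ hσ
    simp only [mem_preimage, mem_Icc] at hσ ⊢
    constructor <;> linarith [hσ.1, hσ.2]
  have h := (hcl.comp_add_right (S.τ k)).mono hpre (uniqueDiffOn_Icc hW)
  exact h.congr_force fun σ hσ x => by
    have hft : S.f (σ + S.τ k) = 0 := hQ _ (h1k.trans (by linarith [hσ.1]))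
    simp only [hft, Pi.zero_apply]

/-- **A free run from the slice IS the translate of a continuation** (quiet schedule, `k ≥ 1`, `ν > 0`, any rates
and margin). Let `s` be a stage at level `k` admitting SOME classical finite-energy continuation `(u₁, p₁)` under
the design force to a time `T₁ > τ k` (agreeing with `s` in velocity and pressure on `[0, τ k]`), and let `(w, r)`
be an UNFORCED classical solution on `[0, W]`, `W > 0`, from the slice `w 0 = s.u (τ k)`, of finite energy and
BOUNDED. Then there is a classical finite-energy continuation `(u, p)` of `s` on `[0, τ k + W]` under the design
force, agreeing with `s` in velocity and pressure on `[0, τ k]`, whose translate is `w`: `u (σ + τ k) = w σ` on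
`[0, W]`. Proof: on the overlap `[τ k, τ k + δ]`, `δ = min (T₁ − τ k, W)`, the translate of `w` and `u₁` are two
finite-energy classical solutions under the (silent) design force with the same value at `τ k`, the first bounded,
so they coincide (`velocity_eq_of_bounded_classical_Icc`); the pressure of `w` is re-gauged to agree with the
translate of `p₁` on `[0, δ]` (`exists_pressure_eq_on_Icc`); then `Stage.exists_glue_translated` glues.
[cite: Sohr2001, Ch. V Thm. 1.5.1] [cite: DoeringGibbon1995, §1.2 eqs (1.2.17)–(1.2.21) (pp. 10–11)] -/
theorem exists_continuation_of_freeRun (hν : 0 < ν) (hQ : S.Quiet) (hk : 1 ≤ k) (s : Stage ν R S m k)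
    (hloc : ∃ T₁ : ℝ, S.τ k < T₁ ∧
      ∃ (u₁ : ℝ → EuclideanSpace ℝ (Fin 3) → EuclideanSpace ℝ (Fin 3)) (p₁ : ℝ → EuclideanSpace ℝ (Fin 3) → ℝ),
        IsClassicalNSSolutionOn (Icc 0 T₁) ν S.f u₁ p₁ ∧
        (∀ t ∈ Icc 0 (S.τ k), u₁ t = s.u t ∧ p₁ t = s.p t) ∧
        (∃ C : ℝ≥0∞, C < ⊤ ∧ ∀ t ∈ Icc 0 T₁, ∫⁻ x, ‖u₁ t x‖ₑ ^ 2 ≤ C))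
    {W : ℝ} (hW : 0 < W)
    {w : ℝ → EuclideanSpace ℝ (Fin 3) → EuclideanSpace ℝ (Fin 3)} {r : ℝ → EuclideanSpace ℝ (Fin 3) → ℝ}
    (hw : IsClassicalNSSolutionOn (Icc 0 W) ν 0 w r) (hw0 : w 0 = s.u (S.τ k))
    (hEw : ∃ C : ℝ≥0∞, C < ⊤ ∧ ∀ σ ∈ Icc 0 W, ∫⁻ x, ‖w σ x‖ₑ ^ 2 ≤ C)
    {B : ℝ} (hwB : ∀ σ ∈ Icc 0 W, ∀ x, ‖w σ x‖ ≤ B) :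
    ∃ (u : ℝ → EuclideanSpace ℝ (Fin 3) → EuclideanSpace ℝ (Fin 3)) (p : ℝ → EuclideanSpace ℝ (Fin 3) → ℝ),
      IsClassicalNSSolutionOn (Icc 0 (S.τ k + W)) ν S.f u p ∧
      (∀ t ∈ Icc 0 (S.τ k), u t = s.u t ∧ p t = s.p t) ∧
      (∃ C : ℝ≥0∞, C < ⊤ ∧ ∀ t ∈ Icc 0 (S.τ k + W), ∫⁻ x, ‖u t x‖ₑ ^ 2 ≤ C) ∧
      ∀ σ ∈ Icc 0 W, u (σ + S.τ k) = w σ := by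
  obtain ⟨T₁, hT₁, u₁, p₁, h₁, h₁s, hE₁⟩ := hloc
  set τk : ℝ := S.τ k with hτk
  have hτk0 : 0 ≤ τk := (S.τ_pos k).le
  have h1k : S.τ 1 ≤ τk := S.τ_mono hk
  -- the overlap length
  set δ : ℝ := min (T₁ - τk) W with hδdef
  have hδ : 0 < δ := lt_min (by linarith) hW
  have hδW : δ ≤ W := min_le_right _ _
  have hδT : τk + δ ≤ T₁ := by have := min_le_left (T₁ - τk) W; linarith
  -- the local continuation restricted to `[0, τ k + δ]`
  have hsub₁ : Icc 0 (τk + δ) ⊆ Icc 0 T₁ := Icc_subset_Icc_right hδT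
  have h₁' : IsClassicalNSSolutionOn (Icc 0 (τk + δ)) ν S.f u₁ p₁ :=
    h₁.mono hsub₁ (uniqueDiffOn_Icc (by linarith))
  have hE₁' : ∃ C : ℝ≥0∞, C < ⊤ ∧ ∀ t ∈ Icc 0 (τk + δ), ∫⁻ x, ‖u₁ t x‖ₑ ^ 2 ≤ C := by
    obtain ⟨C, hC, hb⟩ := hE₁
    exact ⟨C, hC, fun t ht => hb t (hsub₁ ht)⟩
  -- (1) the free run translated back to `[τ k, τ k + δ]` solves the design's (silent) system there
  have hpreb : Icc τk (τk + δ) ⊆ (fun t => t + -τk) ⁻¹' Icc 0 W := by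
    intro t ht
    simp only [mem_preimage, mem_Icc] at ht ⊢
    constructor <;> linarith [ht.1, ht.2]
  have hwb0 : IsClassicalNSSolutionOn (Icc τk (τk + δ)) ν (fun t => (0 : ℝ → EuclideanSpace ℝ (Fin 3) →
      EuclideanSpace ℝ (Fin 3)) (t + -τk)) (fun t => w (t + -τk)) (fun t => r (t + -τk)) :=
    (hw.comp_add_right (-τk)).mono hpreb (uniqueDiffOn_Icc (by linarith))
  have hwbf : IsClassicalNSSolutionOn (Icc τk (τk + δ)) ν S.f (fun t => w (t + -τk))
      (fun t => r (t + -τk)) :=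
    hwb0.congr_force fun t ht x => by
      have hft : S.f t = 0 := hQ t (h1k.trans ht.1)
      simp only [Pi.zero_apply, hft]
  -- (2) uniqueness on the overlap: `u₁ = w(· − τ k)` on `[τ k, τ k + δ]` (`w` is the bounded competitor)
  have hsubo : Icc τk (τk + δ) ⊆ Icc 0 T₁ := fun t ht => ⟨hτk0.trans ht.1, ht.2.trans hδT⟩
  have h₁o : IsClassicalNSSolutionOn (Icc τk (τk + δ)) ν S.f u₁ p₁ :=
    h₁.mono hsubo (uniqueDiffOn_Icc (by linarith))
  have hEwb : ∃ C : ℝ≥0∞, C < ⊤ ∧ ∀ t ∈ Icc τk (τk + δ), ∫⁻ x, ‖w (t + -τk) x‖ₑ ^ 2 ≤ C := by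
    obtain ⟨C, hC, hb⟩ := hEw
    exact ⟨C, hC, fun t ht => hb (t + -τk) (hpreb ht)⟩
  have hBwb : ∀ t ∈ Icc τk (τk + δ), ∀ x, ‖w (t + -τk) x‖ ≤ B := fun t ht x => hwB _ (hpreb ht) x
  have hE₁o : ∃ C : ℝ≥0∞, C < ⊤ ∧ ∀ t ∈ Icc τk (τk + δ), ∫⁻ x, ‖u₁ t x‖ₑ ^ 2 ≤ C := by
    obtain ⟨C, hC, hb⟩ := hE₁
    exact ⟨C, hC, fun t ht => hb t (hsubo ht)⟩
  have h0o : u₁ τk = w (τk + -τk) := by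
    rw [(h₁s τk ⟨hτk0, le_rfl⟩).1, show τk + -τk = 0 by ring, hw0]
  have heqo : ∀ t ∈ Icc τk (τk + δ), u₁ t = w (t + -τk) :=
    velocity_eq_of_bounded_classical_Icc hν hτk0 (by linarith) S.force_smooth S.force_decay hwbf hEwb hBwb
      h₁o hE₁o h0o
  have hagreeδ : ∀ σ ∈ Icc 0 δ, w σ = u₁ (σ + τk) := by
    intro σ hσ
    have h := heqo (σ + τk) ⟨by linarith [hσ.1], by linarith [hσ.2]⟩
    rw [h, show σ + τk + -τk = σ by ring]
  -- (3) the translate of `(u₁, p₁)` to `[0, δ]` is an unforced solution; match the pressure gauge of `w` to it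
  have hpret : Icc 0 δ ⊆ (fun σ => σ + τk) ⁻¹' Icc 0 T₁ := by
    intro σ hσ
    simp only [mem_preimage, mem_Icc] at hσ ⊢
    constructor <;> linarith [hσ.1, hσ.2]
  have hut : IsClassicalNSSolutionOn (Icc 0 δ) ν 0 (fun σ => u₁ (σ + τk)) (fun σ => p₁ (σ + τk)) :=
    ((h₁.comp_add_right τk).mono hpret (uniqueDiffOn_Icc hδ)).congr_force fun σ hσ x => by
      have hft : S.f (σ + τk) = 0 := hQ _ (h1k.trans (by linarith [hσ.1]))
      simp only [hft, Pi.zero_apply]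
  obtain ⟨r', hw', hr'⟩ := hut.exists_pressure_eq_on_Icc hw hδ hδW hagreeδ
  -- (4) glue the re-gauged free run onto the local continuation
  exact s.exists_glue_translated hQ hk hδ hδW h₁' h₁s hE₁' hw' (fun σ hσ => ⟨hagreeδ σ hσ, hr' σ hσ⟩) hEw

end Stage

/-! ## §3 The readout schema is a property of the slice (wide rates, unit viscosity, route margin) -/

/-- **`ReadoutAt k P` ⇔ the free-run schema on every registered level-`k` slice** (`k ≥ 1`, no hypothesis):
every tame continuation of every registered level-`k` stage of a pinned rigid quiet wide design ends with `P` iff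
every tame FREE run over the window from the slice `s.u (τ k)` of every such stage ends with `P`. (⇒) glues the
free run onto the tree's local continuation of the stage across `τ k` (`Stage.exists_continuation_of_freeRun`,
`localContinuationAt_of_forced_local_existence tao2011_smooth_local_existence_forced_holds`); (⇐) translates a
continuation to the origin `τ k`. [cite: Palasek2026ElementaryModel, §4] -/
theorem readoutAt_iff_sliceRun {k : ℕ} (hk : 1 ≤ k)
    {P : Schedule TowerRates.wide → (EuclideanSpace ℝ (Fin 3) → EuclideanSpace ℝ (Fin 3)) → Prop} :
    ReadoutAt k P ↔
      ∀ S : Schedule TowerRates.wide, S.Pins 8 (6 / 5) → S.Rigid → S.Quiet →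
        ∀ s : Stage 1 TowerRates.wide S (Margins.routeG TowerRates.wide) k, SliceRun S k P (s.u (S.τ k)) := by
  constructor
  · intro h S hP hR hQ s w r hw hw0 hEw hwB
    set W : ℝ := S.τ (k + 1) - S.τ k with hWdef
    have hW : 0 < W := by rw [hWdef]; linarith [S.τ_lt_succ k]
    have hloc := localContinuationAt_of_forced_local_existence tao2011_smooth_local_existence_forced_holds k
      S hP hR hQ s
    obtain ⟨u, p, hcl, hagree, hE, hshift⟩ :=
      s.exists_continuation_of_freeRun one_pos hQ hk hloc hW hw hw0 hEw hwB
    have hτ : S.τ k + W = S.τ (k + 1) := by rw [hWdef]; ring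
    rw [hτ] at hcl hE
    have hceil : ∀ t ∈ Icc 0 (S.τ (k + 1)), ∀ x, ‖u t x‖ ≤ S.c₂ * TowerRates.wide.Y (k + 1) := by
      intro t ht x
      rcases le_or_gt t (S.τ k) with htk | htk
      · rw [(hagree t ⟨ht.1, htk⟩).1]
        exact (s.ceiling k le_rfl t ⟨ht.1, htk⟩ x).trans
          (mul_le_mul_of_nonneg_left (TowerRates.wide.Y_le_Y_succ k) s.c₂_pos.le)
      · have hσ : t - S.τ k ∈ Icc 0 W := ⟨by linarith, by rw [hWdef]; linarith [ht.2]⟩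
        have h1 := hshift (t - S.τ k) hσ
        rw [show t - S.τ k + S.τ k = t by ring] at h1
        rw [h1]
        exact hwB _ hσ x
    have hP' := h S hP hR hQ s u p hcl hagree hE hceil
    have hlast : u (S.τ (k + 1)) = w W := by
      rw [← hshift W ⟨hW.le, le_rfl⟩, show W + S.τ k = S.τ (k + 1) by rw [hWdef]; ring]
    rw [hlast] at hP'
    exact hP'
  · intro h S hP hR hQ s u p hcl hagree hE hceil
    have hW : 0 < S.τ (k + 1) - S.τ k := by linarith [S.τ_lt_succ k]
    have hmem : ∀ σ ∈ Icc 0 (S.τ (k + 1) - S.τ k), σ + S.τ k ∈ Icc 0 (S.τ (k + 1)) := fun σ hσ =>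
      ⟨by linarith [hσ.1, (S.τ_pos k).le], by linarith [hσ.2]⟩
    have hw := s.freeRun_of_continuation hQ hk hcl
    have hw0 : (fun σ => u (σ + S.τ k)) 0 = s.u (S.τ k) := by
      show u (0 + S.τ k) = s.u (S.τ k)
      rw [zero_add]
      exact (hagree (S.τ k) ⟨(S.τ_pos k).le, le_rfl⟩).1
    have hEw : ∃ C : ℝ≥0∞, C < ⊤ ∧ ∀ σ ∈ Icc 0 (S.τ (k + 1) - S.τ k),
        ∫⁻ x, ‖(fun σ => u (σ + S.τ k)) σ x‖ₑ ^ 2 ≤ C := by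
      obtain ⟨C, hC, hb⟩ := hE
      exact ⟨C, hC, fun σ hσ => hb _ (hmem σ hσ)⟩
    have hwB : ∀ σ ∈ Icc 0 (S.τ (k + 1) - S.τ k), ∀ x,
        ‖(fun σ => u (σ + S.τ k)) σ x‖ ≤ S.c₂ * TowerRates.wide.Y (k + 1) :=
      fun σ hσ x => hceil _ (hmem σ hσ) x
    have hP' := h S hP hR hQ s _ _ hw hw0 hEw hwB
    simpa only [sub_add_cancel] using hP'

/-- **The speed floor is a property of the slice**: `SpeedFloorAt k ↔` every tame free run over the window from
every registered level-`k` slice ends with speed `≥ c₁ Y_{k+1}` somewhere in the ball (`k ≥ 1`).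
[cite: Palasek2026ElementaryModel, §4] -/
theorem speedFloorAt_iff_sliceRun {k : ℕ} (hk : 1 ≤ k) :
    SpeedFloorAt k ↔
      ∀ S : Schedule TowerRates.wide, S.Pins 8 (6 / 5) → S.Rigid → S.Quiet →
        ∀ s : Stage 1 TowerRates.wide S (Margins.routeG TowerRates.wide) k,
          SliceRun S k (fun S v => ∃ x, ‖x‖ ≤ S.radius ∧ S.c₁ * TowerRates.wide.Y (k + 1) ≤ ‖v x‖)
            (s.u (S.τ k)) :=
  readoutAt_iff_sliceRun hk

/-- **The strain floor is a property of the slice** (`k ≥ 1`). [cite: Palasek2026ElementaryModel, §4] -/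
theorem strainFloorAt_iff_sliceRun {k : ℕ} (hk : 1 ≤ k) :
    StrainFloorAt k ↔
      ∀ S : Schedule TowerRates.wide, S.Pins 8 (6 / 5) → S.Rigid → S.Quiet →
        ∀ s : Stage 1 TowerRates.wide S (Margins.routeG TowerRates.wide) k,
          SliceRun S k (fun S v => ∃ x, ‖x‖ ≤ S.radius ∧ S.c₁ * TowerRates.wide.A (k + 1) ≤ ‖fderiv ℝ v x‖)
            (s.u (S.τ k)) :=
  readoutAt_iff_sliceRun hk

/-- **The core floor is a property of the slice** (`k ≥ 1`). [cite: Palasek2026ElementaryModel, §4] -/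
theorem coreFloorAt_iff_sliceRun {k : ℕ} (hk : 1 ≤ k) :
    CoreFloorAt k ↔
      ∀ S : Schedule TowerRates.wide, S.Pins 8 (6 / 5) → S.Rigid → S.Quiet →
        ∀ s : Stage 1 TowerRates.wide S (Margins.routeG TowerRates.wide) k,
          SliceRun S k (fun S v => ∃ (x : EuclideanSpace ℝ (Fin 3)) (γ : ℝ → EuclideanSpace ℝ (Fin 3)),
            ‖x‖ ≤ S.radius ∧ ContDiff ℝ 1 γ ∧ γ 0 = γ 1 ∧
            (∀ σ ∈ Icc (0 : ℝ) 1, γ σ ∈ Metric.closedBall x (1 / TowerRates.wide.N (k + 1))) ∧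
            (∀ σ ∈ Icc (0 : ℝ) 1, ‖deriv γ σ‖ ≤ 8 * π / TowerRates.wide.N (k + 1)) ∧
            S.c₁ * TowerRates.wide.N (k + 1) ^ (TowerRates.wide.β - 2) ≤ circulation v γ) (s.u (S.τ k)) :=
  readoutAt_iff_sliceRun hk

/-- **The whole lower half is a property of the slice** (`k ≥ 1`): `ReadoutFloorsAt k ↔` every tame free run
over the window from every registered level-`k` slice ends with the level-`(k+1)` LETTER in the ball.
[cite: Palasek2026ElementaryModel, §4] -/
theorem readoutFloorsAt_iff_sliceRun {k : ℕ} (hk : 1 ≤ k) :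
    ReadoutFloorsAt k ↔
      ∀ S : Schedule TowerRates.wide, S.Pins 8 (6 / 5) → S.Rigid → S.Quiet →
        ∀ s : Stage 1 TowerRates.wide S (Margins.routeG TowerRates.wide) k,
          SliceRun S k (fun S v => Letter S (k + 1) v) (s.u (S.τ k)) := by
  rw [readoutFloorsAt_iff_readoutAt_letter]
  exact readoutAt_iff_sliceRun hk

/-- **THE FIRST RUNG (item 19249): the speed stub is a property of the level-1 slice** — `SpeedFloorAt 1` iff
every unforced finite-energy classical run of length `τ₂ − τ₁` from the slice `s.u τ₁` of every registered
level-1 stage of a pinned rigid quiet wide design, staying `≤ (5/3)·Y₂`, ends with speed `≥ Y₂` somewhere in the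
ball. [cite: Palasek2026ElementaryModel, §4] -/
theorem speedFloorAt_one_iff_sliceRun :
    SpeedFloorAt 1 ↔
      ∀ S : Schedule TowerRates.wide, S.Pins 8 (6 / 5) → S.Rigid → S.Quiet →
        ∀ s : Stage 1 TowerRates.wide S (Margins.routeG TowerRates.wide) 1,
          SliceRun S 1 (fun S v => ∃ x, ‖x‖ ≤ S.radius ∧ S.c₁ * TowerRates.wide.Y 2 ≤ ‖v x‖) (s.u (S.τ 1)) :=
  speedFloorAt_iff_sliceRun le_rfl

/-- The first rung: the whole lower stub `ReadoutFloorsAt 1` is a property of the level-1 slice.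
[cite: Palasek2026ElementaryModel, §4] -/
theorem readoutFloorsAt_one_iff_sliceRun :
    ReadoutFloorsAt 1 ↔
      ∀ S : Schedule TowerRates.wide, S.Pins 8 (6 / 5) → S.Rigid → S.Quiet →
        ∀ s : Stage 1 TowerRates.wide S (Margins.routeG TowerRates.wide) 1,
          SliceRun S 1 (fun S v => Letter S 2 v) (s.u (S.τ 1)) :=
  readoutFloorsAt_iff_sliceRun le_rfl

/-! ## §4 The slice-form refutation template -/

/-- **Refutation template, slice form** (`k ≥ 1`): ONE pinned rigid quiet wide schedule, ONE registered
level-`k` stage, and ONE unforced finite-energy classical run over the window from its slice, inside the next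
ceiling, on whose terminal slice `P` FAILS, refute `ReadoutAt k P` (so, instantiated, each of the three floor
stubs). Vacuity warning: no registered stage of level `≥ 1` is known (item 19179 open).
[cite: Palasek2026ElementaryModel, §4] -/
theorem not_readoutAt_of_lazy_slice {k : ℕ} (hk : 1 ≤ k)
    {P : Schedule TowerRates.wide → (EuclideanSpace ℝ (Fin 3) → EuclideanSpace ℝ (Fin 3)) → Prop}
    (hW : ∃ (S : Schedule TowerRates.wide) (s : Stage 1 TowerRates.wide S (Margins.routeG TowerRates.wide) k)
      (w : ℝ → EuclideanSpace ℝ (Fin 3) → EuclideanSpace ℝ (Fin 3)) (r : ℝ → EuclideanSpace ℝ (Fin 3) → ℝ),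
      S.Pins 8 (6 / 5) ∧ S.Rigid ∧ S.Quiet ∧
      IsClassicalNSSolutionOn (Icc 0 (S.τ (k + 1) - S.τ k)) 1 0 w r ∧ w 0 = s.u (S.τ k) ∧
      (∃ C : ℝ≥0∞, C < ⊤ ∧ ∀ σ ∈ Icc 0 (S.τ (k + 1) - S.τ k), ∫⁻ x, ‖w σ x‖ₑ ^ 2 ≤ C) ∧
      (∀ σ ∈ Icc 0 (S.τ (k + 1) - S.τ k), ∀ x, ‖w σ x‖ ≤ S.c₂ * TowerRates.wide.Y (k + 1)) ∧
      ¬ P S (w (S.τ (k + 1) - S.τ k))) :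
    ¬ ReadoutAt k P := by
  intro h
  obtain ⟨S, s, w, r, hP, hR, hQ, hw, hw0, hE, hB, hnot⟩ := hW
  exact hnot ((readoutAt_iff_sliceRun hk).1 h S hP hR hQ s w r hw hw0 hE hB)

end Summit.NavierStokesRegularity.FluidComputer.PalasekTowerClayBridge

end
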